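import Literature.NumberTheory.GaloisCohomology.Howard2004.DVRSettingPiRefinementAssembly
import Literature.NumberTheory.GaloisCohomology.Howard2004.ConclusionCofinalTransferProofs
import HarnessLib

/-!
# Howard 2004, Thm. 1.6.1 on a general `DVRSetting` from Thm. 1.6.1 on its `π`-adic refinement: the
# conclusion transfers back along the cofinal embedding `T^{(k)} ≅ T/π^{e_k}T` (theorems only)

B. Howard, *The Heegner point Kolyvagin system*, Compositio Math. **140** (2004) (arXiv:1202.6340), Thm. 1.6.1
(arXiv Thm. 2.6.1, p. 11 L23–28) and its proof (p. 12 L29–55): the conclusion («`H¹_F(K, T)` free of rank one,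
`H¹_F(K, A) ≅ 𝒟 ⊕ M ⊕ M`, `len M ≤ len(H¹_F(K,T)/Rκ_1)`») only speaks about `lim_k` / `colim_k` over the levels
`T/𝔪^kT`, which a cofinal system of levels computes.  Brick (R8) of the refinement programme (REFINE, cell
`pub/bsd-print-x9`, LEAD ruling (β) «prove Lemma 1.6.4 / Thm. 1.6.1 on FULL settings and refine»): the
instantiation of x10b-p1-w7's generic transfer `DVRSetting.conclusion_of_cofinal` (`ConclusionCofinalTransferProofs`)
at the refined setting `S.refine hy pins` of R6b, with the marked levels `σ k = e_k - 1` (`idxSeqE`), the bijections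
`ι_k = proj : T^{(k)} → T/π^{e_k}T` (R1 §5), the conditions (R3a §6 / `refinedCond_eq_of_le`) and the bottom class
`one♯ = refinedFamily` (R7-TOWER♯):

* §1 `idxSeqE` bookkeeping: `idxSeq (e 0 - 1) (k ↦ e (k+1) - e k) k + 1 = e k`;
* §2 **`DVRSetting.conclusion_of_refine`**: `(S.refine hy pins).Conclusion hy♯ (refinedFamily κ.one) → S.Conclusion hy κ.one`.

THEOREMS ONLY: no definition, no named fact, no instance, no `sorry`.  `thm161_dvrKolyvaginBound` is NOT proved here
(what remains: Lemma 1.6.4 / the levelwise structure Thm. 1.4.2 on FULL settings, the refined Kolyvagin system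
R7-KS♯, and TAME-WLOG); BSD is not proved by any of this.
-/

set_option autoImplicit false

noncomputable section

open Function NumberField IsDedekindDomain Field
open scoped NumberField ContRepresentation Classical

namespace Literature.NumberTheory.GaloisCohomology.Howard2004

open Literature.NumberTheory.GaloisRepresentations
open Literature.NumberTheory.GaloisRepresentations.DiscreteGaloisModule

namespace DVRSetting

variable {p : ℕ} [Fact p.Prime] {K : Type} [Field K] [NumberField K]
  {R : Type} [CommRing R] [IsDomain R] [IsDiscreteValuationRing R] [Algebra ℤ_[p] R]
  {N : ℕ → Type} [∀ k, AddCommGroup (N k)] [∀ k, TopologicalSpace (N k)]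
  [∀ k, DiscreteTopology (N k)] [∀ k, Module R (N k)]
  {Rk : ℕ → Type} [∀ k, CommRing (Rk k)] [∀ k, IsLocalRing (Rk k)] [∀ k, TopologicalSpace (Rk k)]
  [∀ k, DiscreteTopology (Rk k)] [∀ k, Algebra ℤ_[p] (Rk k)] [∀ k, Algebra R (Rk k)]
  [∀ k, Module (Rk k) (N k)] [∀ k, IsScalarTower R (Rk k) (N k)]
  {Nbar : Type} [AddCommGroup Nbar] [TopologicalSpace Nbar] [DiscreteTopology Nbar]
  [∀ k, Module (Rk k) Nbar]
  {Nq : ℕ → Finset (HeightOneSpectrum (𝓞 K)) → Type} [∀ k n, AddCommGroup (Nq k n)]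
  [∀ k n, TopologicalSpace (Nq k n)] [∀ k n, DiscreteTopology (Nq k n)]
  [∀ k n, Module (Rk k) (Nq k n)] [∀ k n, Module R (Nq k n)]
  [∀ k n, IsScalarTower R (Rk k) (Nq k n)]

/-! ## §1 The marked indices `σ k = e_k - 1` of the refinement -/

/-- **The marked indices of the refinement are `e_k - 1`**: with `s₀ = e_0 - 1` and steps `d k = e_{k+1} - e_k`, the
index sequence `idxSeq` (tree `TowerReindex`) satisfies `idxSeq k + 1 = e_k` (`e` strictly increasing, `e_0 ≥ 1`), so the
refined level `idxSeq k` (exponent `idxSeq k + 1`) is `T/π^{e_k}T ≅ T^{(k)}`.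
[cite: Howard2004HeegnerKolyvagin, §1.6 (arXiv p. 11 L33–36, p. 12 L29–33)] -/
theorem idxSeq_e_add_one (S : DVRSetting p K R N Rk Nbar Nq) (hy : S.SatisfiesH) (k : ℕ) :
    idxSeq (S.e 0 - 1) (fun k => S.e (k + 1) - S.e k) k + 1 = S.e k := by
  induction k with
  | zero => exact Nat.sub_add_cancel (S.one_le_e hy 0)
  | succ k ih =>
    rw [idxSeq_succ]
    have hle : S.e k ≤ S.e (k + 1) := (hy.e_strictMono (Nat.lt_succ_self k)).le
    omega

/-! ## §2 The conclusion of Thm. 1.6.1 transfers from the refinement -/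

/-- **Thm. 1.6.1's conclusion for `S` from the conclusion for its `π`-adic refinement** (with the refined bottom
class `refinedFamily κ.one`): the (COFINAL) transfer `conclusion_of_cofinal` along the marked levels
`ι_k = proj : T^{(k)} ≅ T/π^{e_k}T` (bijective, `Γ_K`-equivariant, compatible with the reductions, carrying `F` onto
the refined condition, and `κ_1` onto `refinedFamily κ_1`).
[cite: Howard2004HeegnerKolyvagin, Thm. 1.6.1 and its proof (arXiv Thm. 2.6.1, p. 11 L23–28; p. 12 L29–55)] -/
theorem conclusion_of_refine (S : DVRSetting p K R N Rk Nbar Nq) (hy : S.SatisfiesH)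
    (pins : ∀ v : HeightOneSpectrum (𝓞 K), TamePin v) (κ : S.KolyvaginSystem)
    (h : letI : ∀ i, TopologicalSpace (S.QuotRing (i + 1)) := fun i => S.refineInstTop i
      haveI : ∀ i, DiscreteTopology (S.QuotRing (i + 1)) := fun i => S.refineInst_discrete i
      haveI : ∀ i, IsLocalRing (S.QuotRing (i + 1)) := fun i => S.refineInst_isLocalRing hy i
      letI : ∀ i, Module (S.QuotRing (i + 1)) Nbar := fun i => S.residualModule hy i
      (S.refine hy pins).Conclusion (S.refine_satisfiesH hy pins) (S.refinedFamily hy κ.one)) :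
    S.Conclusion hy κ.one := by
  letI : ∀ i, TopologicalSpace (S.QuotRing (i + 1)) := fun i => S.refineInstTop i
  haveI : ∀ i, DiscreteTopology (S.QuotRing (i + 1)) := fun i => S.refineInst_discrete i
  haveI : ∀ i, IsLocalRing (S.QuotRing (i + 1)) := fun i => S.refineInst_isLocalRing hy i
  letI : ∀ i, Module (S.QuotRing (i + 1)) Nbar := fun i => S.residualModule hy i
  have heσ : ∀ k, idxSeq (S.e 0 - 1) (fun k => S.e (k + 1) - S.e k) k + 1 = S.e k := S.idxSeq_e_add_one hy
  have hone1 : κ.one ∈ S.T.limitH1 := (AddSubgroup.mem_inf.mp κ.one_mem).1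
  exact DVRSetting.conclusion_of_cofinal S (S.refine hy pins) hy (S.refine_satisfiesH hy pins) rfl
    (S.e 0 - 1) (fun k => S.e (k + 1) - S.e k) heσ
    (I := fun k => Ideal.span {(S.piRefinementDatum hy).π ^ (idxSeq (S.e 0 - 1) (fun k => S.e (k + 1) - S.e k) k + 1)})
    (ι := fun k => (S.piRefinementDatum hy).proj (S.host_le_of_eq_e hy (heσ k)))
    (fun k => (S.piRefinementDatum hy).isQuotientBy_levelRep (S.host_le_of_eq_e hy (heσ k)))
    (fun k => LinearMap.ker_eq_bot.mpr (S.proj_bijective_of_eq_e hy (heσ k)).1)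
    (fun k y => S.proj_red_eq_redIter_proj hy (S.host_le_of_eq_e hy (heσ k)) (S.host_le_of_eq_e hy (heσ (k + 1))) y)
    (fun k => S.refinedCond_eq_of_le hy (S.host_le_of_eq_e hy (heσ k)))
    (S.refinedFamily_mem_limitH1 hy hone1)
    (fun k => (S.refinedFamily_apply_of_eq_e hy hone1 (heσ k)).symm) h

end DVRSetting

end Literature.NumberTheory.GaloisCohomology.Howard2004

end
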